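import Summits.BirchSwinnertonDyer.BirchSwinnertonDyer.Theses.SylvesterTwoHeegnerIndex
import Summits.BirchSwinnertonDyer.Rank1Residual.Additive.StrictSelmerIndex
import Literature.NumberTheory.EllipticCurves.VariableChangePoints
import HarnessLib

/-!
# Route `SylvesterTwoHeegnerIndex` (rung K7t), cruxes 19230 / 19229: the strict-Selmer
# BOOKKEEPING stubs of the birth skeleton, proved modulo GZK — and `E_p(ℚ₂)[2] = 0` outright

HONEST FRAMING (cell «bsd-cm», seat `bsd-cm-k7t-c3`, D-0074 group (G)): the birth skeleton
`Cruxes/HeegnerIndexLowerAtTwoHSY/Lines/birth.lean` (planner bsd-cm-plan g9/g10, a61a9288a4220307)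
splits each half of the `2`-adic Heegner-index law on 𝒞_HSY through the strict `2^∞`-Selmer group
`Additive.strictSelmerPInfty W 2`; its two "M" stubs `stub_strictSelmerLeShaAtTwo` (lower) and
`stub_shaLeStrictSelmerAtTwo` (upper) ask for a generator `P₀` of `E_p(ℚ)` modulo torsion, the
vanishing of `E_p(ℚ₂)[2]`, the `2`-adic divisibility level `ν₂` of `P₀` in `E_p(ℚ₂)`, and the
inequality `log₂ #Sel_str ≤ log₂ #Ш + ν₂` (resp. `≥`). AS REGISTERED the two stubs are fact-free and
therefore assert `rank E_p(ℚ) = 1` (Sylvester's conjecture on the class) with no input — not a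
kernel theorem. This file proves BOTH stubs verbatim behind ONE displayed binder, GZK
(`rank_eq_analyticRank_of_analyticRank_le_one`, a conjunct of the route's support item
`PublishedFactsTwo` 19231): `stub_strictSelmerLeShaAtTwo_of_GZK`, `stub_shaLeStrictSelmerAtTwo_of_GZK`
(§3). The one arithmetic input that is NOT bookkeeping is proved outright (§1–§2):
**`E_p(ℚ₂)[2] = 0` for every model of `x³ + y³ = p`** — on `y² = x³ − 432p²` a `2`-torsion point has
`y = 0`, and `x³ = 432p² = 2⁴·27·p²` has no root in `ℚ₂` (`3 ∤ 4 = v₂(432p²)`, `p` odd); transported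
to any model by the tree's `VariableChange.pointEquiv`. The identity `#Sel_str = 2^ν₂ · #Ш[2^∞]` is the
tree theorem `Additive.StrictSha.strictSelmerIndexAt_holds` (every prime, incl. `2`).
WHAT THIS IS NOT: not the XL stubs (`stub_strictSelmerLowerAtTwo` / `…UpperAtTwo`, the open
content), not the crux, not `BSD(E_p, 2)`; no cell of the book closes; no label moves.
[cite: SilvermanAEC2009, Prop. VII.6.3 and III.3.1(b)] [cite: GreenbergLNM1716, §2 (pp. 62–63)]
[cite: HuShuYin2019, p. 4 ("E_n has Weierstrass equation y² = x³ − 432n²")]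
-/

set_option autoImplicit false
set_option linter.dupNamespace false

noncomputable section

open scoped Classical

open WeierstrassCurve NumberField Literature.NumberTheory.EllipticCurves
  Literature.NumberTheory.EllipticCurves.ModularForms
  Literature.NumberTheory.EllipticCurves.Rank1Residual
  Literature.NumberTheory.EllipticCurves.HuShuYin2019
  Summit.BirchSwinnertonDyer.Rank1Residual
  Summit.BirchSwinnertonDyer.Rank1Residual.Additive
  Summit.BirchSwinnertonDyer.BirchSwinnertonDyer.Theses.SylvesterTwoHeegnerIndex

namespace Summit.BirchSwinnertonDyer.BirchSwinnertonDyer.Theorems.SylvesterTwoLower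

/-! ## §1 `x³ = 432p²` has no solution in `ℚ₂`; `2`-torsion of `y² = x³ − 432p²` over `ℚ₂` -/

/-- `v₂(432·p²) = 4` for an odd prime `p` (`432 = 2⁴·27`). [folklore] -/
theorem padicValNat_two_432_mul_sq {p : ℕ} (hp : p.Prime) (hp2 : p ≠ 2) :
    padicValNat 2 (432 * p ^ 2) = 4 := by
  haveI : Fact (Nat.Prime 2) := ⟨Nat.prime_two⟩
  have hp0 : p ≠ 0 := hp.ne_zero
  have hnd : ¬ 2 ∣ p := by
    intro h
    exact hp2 ((Nat.prime_dvd_prime_iff_eq Nat.prime_two hp).mp h).symm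
  have h432 : padicValNat 2 432 = 4 := by
    have : (432 : ℕ) = 2 ^ 4 * 27 := by norm_num
    rw [this, padicValNat.mul (by norm_num) (by norm_num), padicValNat.prime_pow,
      padicValNat.eq_zero_of_not_dvd (by norm_num)]
  rw [padicValNat.mul (by norm_num) (pow_ne_zero _ hp0), h432, padicValNat.pow,
    padicValNat.eq_zero_of_not_dvd hnd]

/-- **No `x ∈ ℚ₂` with `x³ = 432p²`** (`p` an odd prime): `3·v₂(x) = v₂(432p²) = 4` is impossible.
[folklore] -/
theorem padic_cube_ne_432_mul_sq {p : ℕ} (hp : p.Prime) (hp2 : p ≠ 2) (x : ℚ_[2]) :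
    x ^ 3 ≠ (432 * (p : ℚ_[2]) ^ 2) := by
  haveI : Fact (Nat.Prime 2) := ⟨Nat.prime_two⟩
  intro hx
  have hval : (x ^ 3).valuation = ((432 * p ^ 2 : ℕ) : ℚ_[2]).valuation := by
    rw [hx]; push_cast; rfl
  rw [Padic.valuation_pow, Padic.valuation_natCast, padicValNat_two_432_mul_sq hp hp2] at hval
  omega

/-- **`E_p(ℚ₂)[2] = 0` on the cube-sum model**: the base change to `ℚ₂` of
`cubeSumCurve p : y² = x³ − 432p²` (`p` an odd prime) has no point of order `2` — a `2`-torsion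
point `(x, y)` has `y = −y`, so `y = 0` and `x³ = 432p²`, impossible in `ℚ₂`.
[cite: SilvermanAEC2009, III.2.3 (negation formula)] -/
theorem two_torsion_eq_zero_cubeSumCurve_padic {p : ℕ} (hp : p.Prime) (hp2 : p ≠ 2)
    (Q : ((cubeSumCurve (p : ℚ)).baseChange ℚ_[2]).toAffine.Point) (hQ : 2 • Q = 0) : Q = 0 := by
  rcases Q with _ | ⟨x, y, h⟩
  · rfl
  · exfalso
    have hneg : (Affine.Point.some x y h : ((cubeSumCurve (p : ℚ)).baseChange ℚ_[2]).toAffine.Point)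
        = -Affine.Point.some x y h := by
      rw [← add_eq_zero_iff_eq_neg, ← two_nsmul]; exact hQ
    rw [Affine.Point.neg_some, Affine.Point.some.injEq] at hneg
    have hy : y = 0 := by
      have h2 : y = -y := by
        have := hneg.2
        simpa [Affine.negY, cubeSumCurve, WeierstrassCurve.baseChange] using this
      have h3 : (2 : ℚ_[2]) * y = 0 := by linear_combination h2
      simpa using h3
    have heq := (Affine.equation_iff x y).mp h.1
    simp [cubeSumCurve, WeierstrassCurve.baseChange, hy] at heq
    -- heq : x ^ 3 = 432 * p ^ 2  (up to normal form)
    exact padic_cube_ne_432_mul_sq hp hp2 x (by linear_combination -heq)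

/-! ## §2 Transport to every model of `E_p` -/

/-- Torsion-freeness at `2` is transported along an additive isomorphism. [folklore] -/
theorem two_smul_eq_zero_imp_of_addEquiv {A B : Type*} [AddCommGroup A] [AddCommGroup B]
    (e : A ≃+ B) (h : ∀ a : A, 2 • a = 0 → a = 0) (b : B) (hb : 2 • b = 0) : b = 0 := by
  have : e.symm b = 0 := h _ (by rw [← map_nsmul, hb, map_zero])
  simpa using congrArg e this

/-- **`E_p(ℚ₂)[2] = 0` for EVERY model**: if `C • W = cubeSumCurve p` over `ℚ` (`p` an odd prime),
then `W(ℚ₂)` has no point of order `2` (transport along `VariableChange.pointEquiv` over `ℚ₂`,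
`map_variableChange`). [cite: SilvermanAEC2009, III.3.1(b)] -/
theorem two_torsion_eq_zero_padic_of_model {p : ℕ} (hp : p.Prime) (hp2 : p ≠ 2)
    (W : WeierstrassCurve ℚ) (hW : ∃ C : VariableChange ℚ, C • W = cubeSumCurve (p : ℚ))
    (Q : (W.baseChange ℚ_[2]).toAffine.Point) (hQ : 2 • Q = 0) : Q = 0 := by
  obtain ⟨C, hC⟩ := hW
  have heq : (C.map (algebraMap ℚ ℚ_[2])) • (W.baseChange ℚ_[2]) =
      (cubeSumCurve (p : ℚ)).baseChange ℚ_[2] := by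
    rw [WeierstrassCurve.baseChange, WeierstrassCurve.map_variableChange, hC]; rfl
  have htarget : ∀ R : ((C.map (algebraMap ℚ ℚ_[2])) • (W.baseChange ℚ_[2])).toAffine.Point,
      2 • R = 0 → R = 0 := by
    rw [heq]; exact two_torsion_eq_zero_cubeSumCurve_padic hp hp2
  exact two_smul_eq_zero_imp_of_addEquiv
    (VariableChange.pointEquiv (W.baseChange ℚ_[2]) (C.map (algebraMap ℚ ℚ_[2]))).symm htarget Q hQ

/-! ## §3 The two bookkeeping stubs, modulo GZK -/

/-- `p ≡ 4, 7 (mod 9)` forces `p ≠ 2`. [folklore] -/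
theorem ne_two_of_mod_nine {p : ℕ} (h9 : p % 9 = 4 ∨ p % 9 = 7) : p ≠ 2 := by
  rintro rfl; omega

/-- **The strict-Selmer data of a 𝒞_HSY member, modulo GZK.** For a globally minimal `W ≅ E_p`
with `r_an(W) = 1`, granted `rank_eq_analyticRank_of_analyticRank_le_one` (GZK): a generator `P₀`
of `W(ℚ)` modulo torsion exists (Mordell–Weil rank one), `W(ℚ₂)[2] = 0` (§2), `P₀` has an exact
`2`-divisibility level `n` in `W(ℚ₂)` (AEC VII.6.3), `Ш(W)` is finite, and
`ord₂ #Sel_str(W)[2^∞] = n + ord₂ #Ш(W)` (`Additive.StrictSha.strictSelmerIndexAt_holds`).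
[cite: GreenbergLNM1716, §2 (pp. 62–63)] [cite: SilvermanAEC2009, Prop. VII.6.3 and Thm. VIII.6.7] -/
theorem strictSelmer_data_of_GZK (hGZK : rank_eq_analyticRank_of_analyticRank_le_one)
    {p : ℕ} (hp : p.Prime) (h9 : p % 9 = 4 ∨ p % 9 = 7)
    (W : WeierstrassCurve ℚ) [W.IsElliptic] [W.IsGloballyMinimal]
    (hW : ∃ C : VariableChange ℚ, C • W = cubeSumCurve (p : ℚ)) (hr : W.analyticRank = 1) :
    ∃ (P₀ : W.toAffine.Point) (n : ℕ), ¬ IsOfFinAddOrder P₀ ∧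
      (∀ R : W.toAffine.Point, ∃ (m : ℤ) (T : W.toAffine.Point), IsOfFinAddOrder T ∧ R = m • P₀ + T) ∧
      (∀ Q : (W.baseChange ℚ_[2]).toAffine.Point, 2 • Q = 0 → Q = 0) ∧
      (∃ Q : (W.baseChange ℚ_[2]).toAffine.Point, 2 ^ n • Q = W.toPadicPoint 2 P₀) ∧
      (∀ Q : (W.baseChange ℚ_[2]).toAffine.Point, 2 ^ (n + 1) • Q ≠ W.toPadicPoint 2 P₀) ∧
      Finite W.sha ∧
      (padicValNat 2 (Nat.card ↥(strictSelmerPInfty W 2)) : ℤ) =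
        (padicValNat 2 (Nat.card W.sha) : ℤ) + (n : ℤ) := by
  haveI : Fact (Nat.Prime 2) := ⟨Nat.prime_two⟩
  obtain ⟨hrank, hfin⟩ := hGZK W (by rw [hr])
  have hrank1 : W.mordellWeilRank = 1 := by rw [hrank, hr]
  obtain ⟨P, hP, hgen⟩ := exists_generator_of_mordellWeilRank_eq_one W hrank1
  obtain ⟨lam, hlam⟩ := exists_addMonoidHom_padicInt_apply_eq_zero_iff 2 (W.baseChange ℚ_[2])
  have hinj : Function.Injective (W.toPadicPoint 2) :=
    Affine.Point.map_injective (W' := W) (Algebra.ofId ℚ ℚ_[2])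
  have hP' : ¬ IsOfFinAddOrder P := by convert hP
  have hPp : ¬ IsOfFinAddOrder (W.toPadicPoint 2 P) := by
    intro h
    apply hP'
    obtain ⟨m, hm, hmP⟩ := isOfFinAddOrder_iff_nsmul_eq_zero.mp h
    refine isOfFinAddOrder_iff_nsmul_eq_zero.mpr ⟨m, hm, hinj ?_⟩
    rw [map_nsmul, map_zero]
    exact hmP
  obtain ⟨n, hdiv, hndiv⟩ := StrictSha.exists_level_of_not_isOfFinAddOrder 2 lam hlam hPp
  have htors := two_torsion_eq_zero_padic_of_model hp (ne_two_of_mod_nine h9) W hW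
  have hgen' : ∀ R : W.toAffine.Point, ∃ (m : ℤ) (T : W.toAffine.Point),
      IsOfFinAddOrder T ∧ R = m • P + T := fun R => by
    obtain ⟨a, t, ht, hR⟩ := hgen R
    exact ⟨a, t, by convert ht, by convert hR⟩
  haveI := hfin
  haveI : Finite (AddCommGroup.primaryComponent W.sha 2) := Finite.of_injective _ Subtype.val_injective
  have hidx := StrictSha.padicValNat_card_strictSelmerPInfty_eq W 2 hP' hgen' htors hdiv hndiv
  rw [padicValNat_card_addPrimaryComponent 2] at hidx
  refine ⟨P, n, hP', hgen', htors, hdiv, hndiv, hfin, ?_⟩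
  rw [hidx]; push_cast; ring

/-- **Birth-skeleton stub `stub_strictSelmerLeShaAtTwo` (LOWER half's bookkeeping), verbatim, MODULO
GZK** (displayed binder `rank_eq_analyticRank_of_analyticRank_le_one`, a conjunct of
`PublishedFactsTwo`): generator + `2`-adic level exist, `E_p(ℚ₂)[2] = 0`, and
`log₂ #Sel_str ≤ log₂ #Ш + ν₂`. As registered (without the binder) the stub asserts `rank E_p(ℚ) = 1`
unconditionally and is not a kernel theorem. [cite: GreenbergLNM1716, §2 (pp. 62–63)] [cite: SilvermanAEC2009, Prop. VII.6.3] -/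
theorem stub_strictSelmerLeShaAtTwo_of_GZK (hGZK : rank_eq_analyticRank_of_analyticRank_le_one) :
    ∀ (p : ℕ), p.Prime → (p % 9 = 4 ∨ p % 9 = 7) → (¬ ∃ x : ZMod p, x ^ 3 = 3) → ∀ (W : WeierstrassCurve ℚ) [W.IsElliptic] [W.IsGloballyMinimal], (∃ C : WeierstrassCurve.VariableChange ℚ, C • W = Literature.NumberTheory.EllipticCurves.HuShuYin2019.cubeSumCurve (p : ℚ)) → ∀ (N : ℕ) [NeZero N] (K : Type) [Field K] [NumberField K] (Dt : Literature.NumberTheory.EllipticCurves.ModularForms.ModularParametrizationData W N) (H : Literature.NumberTheory.EllipticCurves.HeegnerDatum N (NumberField.discr K)) (ι : K →+* ℂ) (P : (W.baseChange K).toAffine.Point) (Wd : WeierstrassCurve ℚ) [Wd.IsElliptic] [Wd.IsGloballyMinimal] (Cd : WeierstrassCurve.VariableChange ℚ) (k : ℕ), W.HasCM → W.analyticRank = 1 → Literature.NumberTheory.EllipticCurves.IsImaginaryQuadratic K → Literature.NumberTheory.EllipticCurves.SatisfiesHeegnerHypothesis N K → WeierstrassCurve.Affine.Point.map ι.toRatAlgHom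 P = Literature.NumberTheory.EllipticCurves.ModularForms.heegnerPointComplex Dt H → (W.quadraticTwist (NumberField.discr K : ℚ)).entireLFunction 1 ≠ 0 → Cd • W.quadraticTwist (NumberField.discr K : ℚ) = Wd → (k = 1 ∨ k = 2) → (k = 2 ↔ ∀ y : W.toAffine.Point, ∃ Q : (W.baseChange K).toAffine.Point, WeierstrassCurve.QuadraticDescent.incl K W y - (2 : ℤ) • Q ∈ AddCommGroup.torsion (W.baseChange K).toAffine.Point) → ∃ (P₀ : W.toAffine.Point) (n : ℕ), ¬ IsOfFinAddOrder P₀ ∧ (∀ R : W.toAffine.Point, ∃ (m : ℤ) (T : W.toAffine.Point), IsOfFinAddOrder T ∧ R = m • P₀ + T) ∧ (∀ Q : (W.baseChange ℚ_[2]).toAffine.Point, 2 • Q = 0 → Q = 0) ∧ (∃ Q : (W.baseChange ℚ_[2]).toAffine.Point, 2 ^ n • Q = W.toPadicPoint 2 P₀) ∧ (∀ Q : (W.baseChange ℚ_[2]).toAffine.Point, 2 ^ (n + 1) • Q ≠ W.toPadicPoint 2 P₀) ∧ (padicValNat 2 (Nat.card ↥(Summit.BirchSwinnertonDyer.Rank1Residual.Additive.strictSelmerPInfty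 W 2)) : ℤ) ≤ (padicValNat 2 (Nat.card W.sha) : ℤ) + (n : ℤ) := by
  intro p hp h9 _ W _ _ hW _ _ _ _ _ _ _ _ _ _ _ _ _ _ _ hr _ _ _ _ _ _ _
  obtain ⟨P₀, n, h1, h2, h3, h4, h5, -, h6⟩ := strictSelmer_data_of_GZK hGZK hp h9 W hW hr
  exact ⟨P₀, n, h1, h2, h3, h4, h5, h6.le⟩

/-- **Birth-skeleton stub `stub_shaLeStrictSelmerAtTwo` (UPPER half's bookkeeping, crux 19229),
verbatim, MODULO GZK**: same data with `log₂ #Ш + ν₂ ≤ log₂ #Sel_str`.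
[cite: GreenbergLNM1716, §2 (pp. 62–63)] [cite: SilvermanAEC2009, Prop. VII.6.3] -/
theorem stub_shaLeStrictSelmerAtTwo_of_GZK (hGZK : rank_eq_analyticRank_of_analyticRank_le_one) :
    ∀ (p : ℕ), p.Prime → (p % 9 = 4 ∨ p % 9 = 7) → (¬ ∃ x : ZMod p, x ^ 3 = 3) → ∀ (W : WeierstrassCurve ℚ) [W.IsElliptic] [W.IsGloballyMinimal], (∃ C : WeierstrassCurve.VariableChange ℚ, C • W = Literature.NumberTheory.EllipticCurves.HuShuYin2019.cubeSumCurve (p : ℚ)) → ∀ (N : ℕ) [NeZero N] (K : Type) [Field K] [NumberField K] (Dt : Literature.NumberTheory.EllipticCurves.ModularForms.ModularParametrizationData W N) (H : Literature.NumberTheory.EllipticCurves.HeegnerDatum N (NumberField.discr K)) (ι : K →+* ℂ) (P : (W.baseChange K).toAffine.Point) (Wd : WeierstrassCurve ℚ) [Wd.IsElliptic] [Wd.IsGloballyMinimal] (Cd : WeierstrassCurve.VariableChange ℚ) (k : ℕ), W.HasCM → W.analyticRank = 1 → Literature.NumberTheory.EllipticCurves.IsImaginaryQuadratic K → Literature.NumberTheory.EllipticCurves.SatisfiesHeegnerHypothesis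 N K → WeierstrassCurve.Affine.Point.map ι.toRatAlgHom P = Literature.NumberTheory.EllipticCurves.ModularForms.heegnerPointComplex Dt H → (W.quadraticTwist (NumberField.discr K : ℚ)).entireLFunction 1 ≠ 0 → Cd • W.quadraticTwist (NumberField.discr K : ℚ) = Wd → (k = 1 ∨ k = 2) → (k = 2 ↔ ∀ y : W.toAffine.Point, ∃ Q : (W.baseChange K).toAffine.Point, WeierstrassCurve.QuadraticDescent.incl K W y - (2 : ℤ) • Q ∈ AddCommGroup.torsion (W.baseChange K).toAffine.Point) → ∃ (P₀ : W.toAffine.Point) (n : ℕ), ¬ IsOfFinAddOrder P₀ ∧ (∀ R : W.toAffine.Point, ∃ (m : ℤ) (T : W.toAffine.Point), IsOfFinAddOrder T ∧ R = m • P₀ + T) ∧ (∀ Q : (W.baseChange ℚ_[2]).toAffine.Point, 2 • Q = 0 → Q = 0) ∧ (∃ Q : (W.baseChange ℚ_[2]).toAffine.Point, 2 ^ n • Q = W.toPadicPoint 2 P₀) ∧ (∀ Q : (W.baseChange ℚ_[2]).toAffine.Point, 2 ^ (n + 1) • Q ≠ W.toPadicPoint 2 P₀) ∧ (padicValNat 2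 (Nat.card W.sha) : ℤ) + (n : ℤ) ≤ (padicValNat 2 (Nat.card ↥(Summit.BirchSwinnertonDyer.Rank1Residual.Additive.strictSelmerPInfty W 2)) : ℤ) := by
  intro p hp h9 _ W _ _ hW _ _ _ _ _ _ _ _ _ _ _ _ _ _ _ hr _ _ _ _ _ _ _
  obtain ⟨P₀, n, h1, h2, h3, h4, h5, -, h6⟩ := strictSelmer_data_of_GZK hGZK hp h9 W hW hr
  exact ⟨P₀, n, h1, h2, h3, h4, h5, h6.ge⟩

/-! ## §4 Modulo GZK the XL stubs are EQUIVALENT to their cruxes (the strict-Selmer split is a change of currency) -/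

/-- With the data of a registered XL stub in hand, the strict-Selmer index identity pins
`log₂ #Sel_str(W)[2^∞] = n + ord₂ #Ш(W)` for THAT generator/level pair (`strictSelmerIndexAt_holds`),
granted `Ш(W)` finite. [cite: GreenbergLNM1716, §2 (pp. 62–63)] -/
theorem log_strictSelmer_eq_of_data (W : WeierstrassCurve ℚ) [W.IsElliptic] [Finite W.sha]
    {P₀ : W.toAffine.Point} {n : ℕ} (h1 : ¬ IsOfFinAddOrder P₀)
    (h2 : ∀ R : W.toAffine.Point, ∃ (m : ℤ) (T : W.toAffine.Point), IsOfFinAddOrder T ∧ R = m • P₀ + T)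
    (h3 : ∀ Q : (W.baseChange ℚ_[2]).toAffine.Point, 2 • Q = 0 → Q = 0)
    (h4 : ∃ Q : (W.baseChange ℚ_[2]).toAffine.Point, 2 ^ n • Q = W.toPadicPoint 2 P₀)
    (h5 : ∀ Q : (W.baseChange ℚ_[2]).toAffine.Point, 2 ^ (n + 1) • Q ≠ W.toPadicPoint 2 P₀) :
    (padicValNat 2 (Nat.card ↥(strictSelmerPInfty W 2)) : ℤ) = (n : ℤ) + (padicValNat 2 (Nat.card W.sha) : ℤ) := by
  haveI : Fact (Nat.Prime 2) := ⟨Nat.prime_two⟩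
  haveI : Finite (AddCommGroup.primaryComponent W.sha 2) := Finite.of_injective _ Subtype.val_injective
  have hidx := StrictSha.padicValNat_card_strictSelmerPInfty_eq W 2 h1 h2 h3 h4 h5
  rw [padicValNat_card_addPrimaryComponent 2] at hidx
  rw [hidx]; push_cast; ring

/-- **Modulo GZK, the XL stub `stub_strictSelmerLowerAtTwo` is EQUIVALENT to the crux
`HeegnerIndexLowerAtTwoHSY`** (item 19230): `←` is the skeleton's composition (data from
`strictSelmer_data_of_GZK`, then `linarith`); `→` because for ANY generator/level pair the index
identity reads `log₂ #Sel_str = n + ord₂ #Ш`, so `n + ord₂ 𝔮 ≤ log₂ #Sel_str ⟺ ord₂ 𝔮 ≤ ord₂ #Ш`.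
The strict-Selmer split of the birth skeleton is thus a change of currency (toward the
main-conjecture side), not a weakening: the XL stub carries exactly the crux's content.
[cite: GreenbergLNM1716, §2 (pp. 62–63)] [cite: Miller2011LMS, Def. 1.1] -/
theorem heegnerIndexLowerAtTwoHSY_iff_strictSelmerLower_of_GZK
    (hGZK : rank_eq_analyticRank_of_analyticRank_le_one) :
    HeegnerIndexLowerAtTwoHSY ↔ (∀ (p : ℕ), p.Prime → (p % 9 = 4 ∨ p % 9 = 7) → (¬ ∃ x : ZMod p, x ^ 3 = 3) → ∀ (W : WeierstrassCurve ℚ) [W.IsElliptic] [W.IsGloballyMinimal], (∃ C : WeierstrassCurve.VariableChange ℚ, C • W = Literature.NumberTheory.EllipticCurves.HuShuYin2019.cubeSumCurve (p : ℚ)) → ∀ (N : ℕ) [NeZero N] (K : Type) [Field K] [NumberField K] (Dt : Literature.NumberTheory.EllipticCurves.ModularForms.ModularParametrizationData W N) (H : Literature.NumberTheory.EllipticCurves.HeegnerDatum N (NumberField.discr K)) (ι : K →+* ℂ) (P : (W.baseChange K).toAffine.Point) (Wd : WeierstrassCurve ℚ) [Wd.IsElliptic] [Wd.IsGloballyMinimal]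 (Cd : WeierstrassCurve.VariableChange ℚ) (k : ℕ), W.HasCM → W.analyticRank = 1 → Literature.NumberTheory.EllipticCurves.IsImaginaryQuadratic K → Literature.NumberTheory.EllipticCurves.SatisfiesHeegnerHypothesis N K → WeierstrassCurve.Affine.Point.map ι.toRatAlgHom P = Literature.NumberTheory.EllipticCurves.ModularForms.heegnerPointComplex Dt H → (W.quadraticTwist (NumberField.discr K : ℚ)).entireLFunction 1 ≠ 0 → Cd • W.quadraticTwist (NumberField.discr K : ℚ) = Wd → (k = 1 ∨ k = 2) → (k = 2 ↔ ∀ y : W.toAffine.Point, ∃ Q : (W.baseChange K).toAffine.Point, WeierstrassCurve.QuadraticDescent.incl K W y - (2 : ℤ) • Q ∈ AddCommGroup.torsion (W.baseChange K).toAffine.Point) → ∀ (P₀ : W.toAffine.Point) (n : ℕ), ¬ IsOfFinAddOrder P₀ → (∀ R : W.toAffine.Point, ∃ (m : ℤ) (T : W.toAffine.Point), IsOfFinAddOrder T ∧ R = m • P₀ + T) → (∀ Q : (W.baseChange ℚ_[2]).toAffine.Point, 2 • Q = 0 → Q = 0) → (∃ Q : (W.baseChange ℚ_[2]).toAffine.Point,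 2 ^ n • Q = W.toPadicPoint 2 P₀) → (∀ Q : (W.baseChange ℚ_[2]).toAffine.Point, 2 ^ (n + 1) • Q ≠ W.toPadicPoint 2 P₀) → (n : ℤ) + padicValRat 2 (Summit.BirchSwinnertonDyer.Rank1Residual.P2.cmHeegnerIndexQuotient W K P Dt.c k Wd Cd.u) ≤ (padicValNat 2 (Nat.card ↥(Summit.BirchSwinnertonDyer.Rank1Residual.Additive.strictSelmerPInfty W 2)) : ℤ)) := by
  constructor
  · intro hlo p hp h9 h3 W _ _ hW N _ K _ _ Dt H ι P Wd _ _ Cd k hcm hr hK hHN hP hLt hWd hk12 hkiff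
      P₀ n h1 h2 h3' h4 h5
    haveI : Finite W.sha := (hGZK W (by rw [hr])).2
    have hle := hlo p hp h9 h3 W hW N K Dt H ι P Wd Cd k hcm hr hK hHN hP hLt hWd hk12 hkiff
    have heq := log_strictSelmer_eq_of_data W h1 h2 h3' h4 h5
    linarith
  · intro hA p hp h9 h3 W _ _ hW N _ K _ _ Dt H ι P Wd _ _ Cd k hcm hr hK hHN hP hLt hWd hk12 hkiff
    obtain ⟨P₀, n, h1, h2, h3', h4, h5, hfin, h6⟩ := strictSelmer_data_of_GZK hGZK hp h9 W hW hr
    have h7 := hA p hp h9 h3 W hW N K Dt H ι P Wd Cd k hcm hr hK hHN hP hLt hWd hk12 hkiff P₀ n h1 h2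
      h3' h4 h5
    linarith

/-- **Modulo GZK, the XL stub `stub_strictSelmerUpperAtTwo` is EQUIVALENT to the crux
`HeegnerIndexUpperAtTwoHSY`** (item 19229) — same argument, other inequality.
[cite: GreenbergLNM1716, §2 (pp. 62–63)] [cite: Miller2011LMS, Def. 1.1] -/
theorem heegnerIndexUpperAtTwoHSY_iff_strictSelmerUpper_of_GZK
    (hGZK : rank_eq_analyticRank_of_analyticRank_le_one) :
    HeegnerIndexUpperAtTwoHSY ↔ (∀ (p : ℕ), p.Prime → (p % 9 = 4 ∨ p % 9 = 7) → (¬ ∃ x : ZMod p, x ^ 3 = 3) → ∀ (W : WeierstrassCurve ℚ) [W.IsElliptic] [W.IsGloballyMinimal], (∃ C : WeierstrassCurve.VariableChange ℚ, C • W = Literature.NumberTheory.EllipticCurves.HuShuYin2019.cubeSumCurve (p : ℚ)) → ∀ (N : ℕ) [NeZero N] (K : Type) [Field K] [NumberField K] (Dt : Literature.NumberTheory.EllipticCurves.ModularForms.ModularParametrizationData W N) (H : Literature.NumberTheory.EllipticCurves.HeegnerDatum N (NumberField.discr K)) (ι : K →+* ℂ) (P : (W.baseChange K).toAffine.Point)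 (Wd : WeierstrassCurve ℚ) [Wd.IsElliptic] [Wd.IsGloballyMinimal] (Cd : WeierstrassCurve.VariableChange ℚ) (k : ℕ), W.HasCM → W.analyticRank = 1 → Literature.NumberTheory.EllipticCurves.IsImaginaryQuadratic K → Literature.NumberTheory.EllipticCurves.SatisfiesHeegnerHypothesis N K → WeierstrassCurve.Affine.Point.map ι.toRatAlgHom P = Literature.NumberTheory.EllipticCurves.ModularForms.heegnerPointComplex Dt H → (W.quadraticTwist (NumberField.discr K : ℚ)).entireLFunction 1 ≠ 0 → Cd • W.quadraticTwist (NumberField.discr K : ℚ) = Wd → (k = 1 ∨ k = 2) → (k = 2 ↔ ∀ y : W.toAffine.Point, ∃ Q : (W.baseChange K).toAffine.Point, WeierstrassCurve.QuadraticDescent.incl K W y - (2 : ℤ) • Q ∈ AddCommGroup.torsion (W.baseChange K).toAffine.Point) → ∀ (P₀ : W.toAffine.Point) (n : ℕ), ¬ IsOfFinAddOrder P₀ → (∀ R : W.toAffine.Point, ∃ (m : ℤ) (T : W.toAffine.Point), IsOfFinAddOrder T ∧ R = m • P₀ + T) → (∀ Q : (W.baseChange ℚ_[2]).toAffine.Point,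 2 • Q = 0 → Q = 0) → (∃ Q : (W.baseChange ℚ_[2]).toAffine.Point, 2 ^ n • Q = W.toPadicPoint 2 P₀) → (∀ Q : (W.baseChange ℚ_[2]).toAffine.Point, 2 ^ (n + 1) • Q ≠ W.toPadicPoint 2 P₀) → (padicValNat 2 (Nat.card ↥(Summit.BirchSwinnertonDyer.Rank1Residual.Additive.strictSelmerPInfty W 2)) : ℤ) ≤ (n : ℤ) + padicValRat 2 (Summit.BirchSwinnertonDyer.Rank1Residual.P2.cmHeegnerIndexQuotient W K P Dt.c k Wd Cd.u)) := by
  constructor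
  · intro hup p hp h9 h3 W _ _ hW N _ K _ _ Dt H ι P Wd _ _ Cd k hcm hr hK hHN hP hLt hWd hk12 hkiff
      P₀ n h1 h2 h3' h4 h5
    haveI : Finite W.sha := (hGZK W (by rw [hr])).2
    have hle := hup p hp h9 h3 W hW N K Dt H ι P Wd Cd k hcm hr hK hHN hP hLt hWd hk12 hkiff
    have heq := log_strictSelmer_eq_of_data W h1 h2 h3' h4 h5
    linarith
  · intro hA p hp h9 h3 W _ _ hW N _ K _ _ Dt H ι P Wd _ _ Cd k hcm hr hK hHN hP hLt hWd hk12 hkiff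
    obtain ⟨P₀, n, h1, h2, h3', h4, h5, hfin, h6⟩ := strictSelmer_data_of_GZK hGZK hp h9 W hW hr
    have h7 := hA p hp h9 h3 W hW N K Dt H ι P Wd Cd k hcm hr hK hHN hP hLt hWd hk12 hkiff P₀ n h1 h2
      h3' h4 h5
    linarith

end Summit.BirchSwinnertonDyer.BirchSwinnertonDyer.Theorems.SylvesterTwoLower

end
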